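import Summits.QuantumFields.BalabanUV.T4Continuum.Support.B13StepTermFamily
import Summits.QuantumFields.BalabanUV.T4Continuum.Support.TermRepOfSeries

/-!
# NE5 ∕ U3 — row O1-d3, part d3-ii: `TermRep` for THE B13 TERM FAMILY (`B13StepTermFamily.term ∕ out`, row O1-d2) from
# the displayed termwise majorant, and its SPLIT into an ACTIVITY majorant ((2.38)-shape) × the COMBINATORIAL convergence
# of the Ursell series ([26]-shape) — claim table `t4/b2b-balaban-t4-ne5-p1/O1-CLAIM-TABLE-NE5-P1.md` row O1-d, part d3

Cell `pub-balaban`, unit `b2b-balaban-t4-ne5-formalise-leaf-04` (NE5 formalisation swarm, LEAF PROVER 04).  Summits-side new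
work under the LEAN PLACEMENT RULE (cell bookkeeping; NOT a Literature module).  HONEST FRAMING: rung (B)+1 of the FINITE-VOLUME
T⁴ continuum programme — NOT infinite volume, NOT a mass gap, NOT the Clay problem, NOT a proof of NE5 (NOT PRINTED in
[Balaban1987RG1]–[Balaban1989LargeFieldII]; they print ε-UNIFORM bounds, never η-RATES).  HONEST DEPENDENCY (cell line, verbatim):
continuum YM on T⁴ ⇐ BetaPertH ∧ nine spine estimates (0/9 proved); BetaPertH ⇐ (D1) ∧ (D4) ∧ CAP+tail; G-an2-4 gates asym, D1
and NE2/3/4.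

WHAT THIS FILE DOES.  Row O1-d2 (`B13StepTermFamily`, leaf-08, p207797) types the one-step output of [Balaban1988RG2Cluster]
(2.13) p. 14 as `out 𝒯 inc act k o h X := ∑' i, term 𝒯 inc act k i o h X`, `term = 𝟙[Rel k i X]·((n+1)!)⁻¹ρᵀ(poly i)·Π_m act
(poly i m) (lab i m) o h` (Ursell terms of ACTIVITY TERMS `act`).  Row O1-d3 asks `TermRep M K (term 𝒯 inc act) W` for the model
whose `Out` is that functional.  Here, for ANY step model `M` with `M.Out = out 𝒯 inc act` pointwise (what O1-e's `B13Step` will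
satisfy by `rfl`), with no estimate proved and nothing asserted about Bałaban's objects:
* §1 `outIsSeries_b13`: `TermRepOfSeries.OutIsSeries M (term 𝒯 inc act)` (leaf-08's `out_eq_tsum`); `TermRep` from the leaf's
  X-blind displayed majorant `TermBound`∕`TermBudget` (`termRep_b13_of_termBound`, `termRep_b13_of_termBudget`, via
  `TermRepOfSeries.termRep_of_outIsSeriesOn`) and from an X-DEPENDENT displayed majorant (`termRep_b13_of_boundAt`, via leaf-08's
  `termRep_of_summable` — row O1-d1's finding, journal l.5621: with absolute labels only a per-domain majorant is volume-uniform);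
* §2 THE SPLIT OF THE MAJORANT ALONG THE TERM'S STRUCTURE: an ACTIVITY majorant `‖act Z j q.1 q.2‖ ≤ A Z j` on the factors
  of the tuples localizing at `X` (the SHAPE of [Balaban1988RG2Cluster] Lemma 3 (2.38) p. 20 — *"|H(Z)| ≤ …"* — read per resummed
  term; displayed, locator only) gives the termwise bound `‖term k i q X‖ ≤ actMajorant 𝒯 inc A k X i := 𝟙[Rel]·‖coeff i‖·Π_m A …`
  (`norm_term_le_actMajorant`); hence `TermRep` from the activity majorant plus the SUMMABILITY of `actMajorant … k X` over the
  localizing tuples (`termRep_b13_of_actBound`) — the latter is exactly the combinatorial convergence of the Ursell series that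
  print delegates to *"[26, 67, 25, 50]"* (p. 20) and performs as (2.39)–(2.41) p. 21: a DISPLAYED binder here, to be discharged
  by the tree's cluster-expansion kernels (tree-graph inequality `Dimock2011to13.UrsellTreeGraphBound.abs_hcUrsell_le_card_
  treeGraphs` + the template lineage's App. B step 4 summation, in progress — NOT claimed here);
* §3 the per-domain CLASS BOUND from the same split: activity majorant + `∑' i, actMajorant … k X i ≤ G·e^{−κd(X)}` per step-`k`
  domain (the per-X form in which (2.41) p. 21 is printed) ⟹ `ClassBound M K W κ G` (`classBound_b13_of_actBound`).
So d3 for the B13 family is reduced BY NAME to two displayed one-run binders of the printed KIND — the activity bound (2.38) and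
the convergence of the polymer expansion given it — with the X-dependence that row O1-d1 showed necessary.  0 sorry; no new axioms.
-/

noncomputable section

open scoped BigOperators

namespace Summit.QuantumFields.BalabanUV.T4Continuum.B13TermRep

open Literature.MathematicalPhysics.QuantumFieldTheory.Balaban1983to89.T4OutputRate (Carriers)
open Literature.MathematicalPhysics.QuantumFieldTheory.Balaban1983to89.T4InputCauchyRateData (StepModel)
open Literature.MathematicalPhysics.QuantumFieldTheory.Balaban1983to89.T4InputCauchyRateSpecies (ClassBound)
open Literature.MathematicalPhysics.QuantumFieldTheory.Balaban1983to89.T4InputCauchyRateTermwise (TermRep TermBound TermBudget)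
open Summit.QuantumFields.BalabanUV.T4Continuum.B13StepTermFamily
  (TermIndexing coeff term out out_eq_tsum term_of_rel term_of_not_rel termRep_of_summable)
open Summit.QuantumFields.BalabanUV.T4Continuum.TermRepOfSeries
  (OutIsSeries OutIsSeriesOn outIsSeriesOn_of_outIsSeries termRep_of_outIsSeriesOn termRep_of_outIsSeriesOn_budget)

variable {C : Carriers} {ι P J Op Hist : Type*} (𝒯 : TermIndexing C ι P J) (inc : P → P → Prop) [DecidableRel inc]
  (act : P → J → Op → Hist → ℂ)

/-! ## §1 `TermRep` for the B13 family from the displayed termwise majorants -/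

section FromMajorant

variable [NormedAddCommGroup Op] [NormedSpace ℂ Op] [NormedAddCommGroup Hist] [NormedSpace ℂ Hist]

/-- [folklore] A step model whose output IS leaf-08's `out 𝒯 inc act` (pointwise) satisfies the identification shape
`OutIsSeries M (term 𝒯 inc act)` — `out` is the series of its terms by definition (`out_eq_tsum`). -/
theorem outIsSeries_b13 {M : StepModel C Op Hist} (hM : ∀ k o h X, M.Out k o h X = out 𝒯 inc act k o h X) :
    OutIsSeries M (term 𝒯 inc act) :=
  fun k o h X => (hM k o h X).trans (out_eq_tsum 𝒯 inc act k o h X)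

/-- [folklore] The same on any class and window. -/
theorem outIsSeriesOn_b13 {M : StepModel C Op Hist} (hM : ∀ k o h X, M.Out k o h X = out 𝒯 inc act k o h X)
    (K : ℕ → (ℕ → ℝ) → C.BgB → Set (Op × Hist)) (W : Set (ℕ → ℝ)) : OutIsSeriesOn M (term 𝒯 inc act) K W :=
  outIsSeriesOn_of_outIsSeries (outIsSeries_b13 𝒯 inc act hM) K W

/-- [folklore] **ROW O1-d3 FOR THE B13 FAMILY, X-blind majorant**: `M.Out = out 𝒯 inc act` + the termwise leaf's displayed
`TermBound K (term 𝒯 inc act) W κ a` with summable weights ⟹ `TermRep M K (term 𝒯 inc act) W`.  (Row O1-d1's finding l.5621: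
with ABSOLUTE labels this X-blind form is volume-extensive — use `termRep_b13_of_boundAt` or re-code the labels.) -/
theorem termRep_b13_of_termBound {M : StepModel C Op Hist} (hM : ∀ k o h X, M.Out k o h X = out 𝒯 inc act k o h X)
    {K : ℕ → (ℕ → ℝ) → C.BgB → Set (Op × Hist)} {W : Set (ℕ → ℝ)} {κ : ℝ} {a : ℕ → ι → ℝ}
    (hbd : TermBound K (term 𝒯 inc act) W κ a) (ha : ∀ k, Summable (a k)) : TermRep M K (term 𝒯 inc act) W :=
  termRep_of_outIsSeriesOn (outIsSeriesOn_b13 𝒯 inc act hM K W) hbd ha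

/-- [folklore] The same with the summability read from the leaf's `TermBudget a G`. -/
theorem termRep_b13_of_termBudget {M : StepModel C Op Hist} (hM : ∀ k o h X, M.Out k o h X = out 𝒯 inc act k o h X)
    {K : ℕ → (ℕ → ℝ) → C.BgB → Set (Op × Hist)} {W : Set (ℕ → ℝ)} {κ G : ℝ} {a : ℕ → ι → ℝ}
    (hbd : TermBound K (term 𝒯 inc act) W κ a) (hbud : TermBudget a G) : TermRep M K (term 𝒯 inc act) W :=
  termRep_of_outIsSeriesOn_budget (outIsSeriesOn_b13 𝒯 inc act hM K W) hbd hbud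

/-- [folklore] **ROW O1-d3 FOR THE B13 FAMILY, X-DEPENDENT majorant**: `M.Out = out 𝒯 inc act` + a displayed majorant
`‖term k i q.1 q.2 X‖ ≤ a k X i · e^{−κd(X)}` whose weights are summable AT EACH step-`k` DOMAIN ⟹ `TermRep` (comparison test +
leaf-08's `termRep_of_summable`).  The per-domain form row O1-d1 showed necessary for absolute labels. -/
theorem termRep_b13_of_boundAt {M : StepModel C Op Hist} (hM : ∀ k o h X, M.Out k o h X = out 𝒯 inc act k o h X)
    {K : ℕ → (ℕ → ℝ) → C.BgB → Set (Op × Hist)} {W : Set (ℕ → ℝ)} {κ : ℝ} {a : ℕ → C.Dom → ι → ℝ}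
    (hbd : ∀ k, ∀ g ∈ W, ∀ (U : C.BgB) (q : Op × Hist), q ∈ K k g U → ∀ X : C.Dom, C.scale X = k →
      ∀ i, ‖term 𝒯 inc act k i q.1 q.2 X‖ ≤ a k X i * Real.exp (-(κ * C.d X)))
    (ha : ∀ (k : ℕ) (X : C.Dom), C.scale X = k → Summable (a k X)) : TermRep M K (term 𝒯 inc act) W :=
  termRep_of_summable 𝒯 inc act M hM K W fun k g hg U q hq X hX =>
    Summable.of_norm_bounded ((ha k X hX).mul_right (Real.exp (-(κ * C.d X)))) fun i => hbd k g hg U q hq X hX i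

end FromMajorant

/-! ## §2 The split: ACTIVITY majorant × COMBINATORIAL convergence of the Ursell series -/

section Split

/-- [folklore] THE COMBINATORIAL MAJORANT of the term family induced by an activity majorant `A : P → J → ℝ`: zero off the
localization relation, and `‖((n+1)!)⁻¹ρᵀ(poly i)‖ · Π_m A (poly i m) (lab i m)` on it.  Its summability over the tuples
localizing at `X` is the convergence of the polymer expansion (2.13) given the activity bound — what print delegates to
*"[26, 67, 25, 50]"* (p. 20) and performs as (2.39)–(2.41) p. 21; displayed below, NOT proved here. -/
def actMajorant (A : P → J → ℝ) (k : ℕ) (X : C.Dom) (i : ι) : ℝ :=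
  if 𝒯.Rel k i X then ‖coeff 𝒯 inc i‖ * ∏ m, A (𝒯.poly i m) (𝒯.lab i m) else 0

variable {𝒯 inc act}

/-- [folklore] On the localization relation the combinatorial majorant is the coefficient norm times the product of the
activity majorants. -/
theorem actMajorant_of_rel {A : P → J → ℝ} {k : ℕ} {i : ι} {X : C.Dom} (h : 𝒯.Rel k i X) :
    actMajorant 𝒯 inc A k X i = ‖coeff 𝒯 inc i‖ * ∏ m, A (𝒯.poly i m) (𝒯.lab i m) := if_pos h

/-- [folklore] Off the localization relation the combinatorial majorant vanishes. -/
theorem actMajorant_of_not_rel {A : P → J → ℝ} {k : ℕ} {i : ι} {X : C.Dom} (h : ¬ 𝒯.Rel k i X) :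
    actMajorant 𝒯 inc A k X i = 0 := if_neg h

/-- [folklore] **ACTIVITY MAJORANT ⟹ TERMWISE MAJORANT**: if every factor of a tuple localizing at `X` has its activity term
bounded, `‖act (poly i m) (lab i m) o h‖ ≤ A (poly i m) (lab i m)`, then `‖term k i o h X‖ ≤ actMajorant A k X i`
(`norm_mul`, `norm_prod`, `Finset.prod_le_prod`). -/
theorem norm_term_le_actMajorant {A : P → J → ℝ} {k : ℕ} {i : ι} {o : Op} {h : Hist} {X : C.Dom}
    (hA : 𝒯.Rel k i X → ∀ m, ‖act (𝒯.poly i m) (𝒯.lab i m) o h‖ ≤ A (𝒯.poly i m) (𝒯.lab i m)) :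
    ‖term 𝒯 inc act k i o h X‖ ≤ actMajorant 𝒯 inc A k X i := by
  by_cases hrel : 𝒯.Rel k i X
  · rw [term_of_rel 𝒯 inc act hrel, actMajorant_of_rel hrel, norm_mul, norm_prod]
    exact mul_le_mul_of_nonneg_left
      (Finset.prod_le_prod (fun m _ => norm_nonneg _) fun m _ => hA hrel m) (norm_nonneg _)
  · rw [term_of_not_rel 𝒯 inc act hrel, actMajorant_of_not_rel hrel, norm_zero]

/-- [folklore] The combinatorial majorant is nonnegative when the activity majorant is (e.g. whenever it bounds a norm). -/
theorem actMajorant_nonneg {A : P → J → ℝ} (hA : ∀ Z j, 0 ≤ A Z j) (k : ℕ) (X : C.Dom) (i : ι) :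
    0 ≤ actMajorant 𝒯 inc A k X i := by
  by_cases hrel : 𝒯.Rel k i X
  · rw [actMajorant_of_rel hrel]
    exact mul_nonneg (norm_nonneg _) (Finset.prod_nonneg fun m _ => hA _ _)
  · rw [actMajorant_of_not_rel hrel]

variable [NormedAddCommGroup Op] [NormedSpace ℂ Op] [NormedAddCommGroup Hist] [NormedSpace ℂ Hist]

omit [NormedAddCommGroup Op] [NormedSpace ℂ Op] [NormedAddCommGroup Hist] [NormedSpace ℂ Hist] in
/-- [folklore] **SUMMABILITY OF THE B13 FAMILY FROM THE SPLIT**: an activity majorant `A` at the input point and the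
summability of `actMajorant A k X` over the index type give summability of the terms at `(k, X)` (`Summable.of_norm_bounded`). -/
theorem summable_term_of_actBound {A : P → J → ℝ} {k : ℕ} {o : Op} {h : Hist} {X : C.Dom}
    (hA : ∀ i, 𝒯.Rel k i X → ∀ m, ‖act (𝒯.poly i m) (𝒯.lab i m) o h‖ ≤ A (𝒯.poly i m) (𝒯.lab i m))
    (hconv : Summable (actMajorant 𝒯 inc A k X)) : Summable fun i => term 𝒯 inc act k i o h X :=
  Summable.of_norm_bounded hconv fun i => norm_term_le_actMajorant (hA i)

variable (𝒯 inc act) in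
/-- [folklore] **ROW O1-d3 FOR THE B13 FAMILY FROM THE SPLIT BINDERS.**  For a step model with `M.Out = out 𝒯 inc act`:
(i) an ACTIVITY MAJORANT on the class — at every class point `q ∈ K k g U`, every factor of every tuple localizing at a
step-`k` domain `X` has `‖act Z j q.1 q.2‖ ≤ A k g U Z j` (the SHAPE of [Balaban1988RG2Cluster] Lemma 3 (2.38) p. 20 read per
resummed term; displayed, locator only); (ii) the COMBINATORIAL CONVERGENCE `Summable (actMajorant (A k g U) k X)` at every
step-`k` domain (the SHAPE of p. 20's *"sufficient conditions for convergence of the series (2.12), (2.13) are satisfied, see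
[26, 67, 25, 50]"*; displayed) ⟹ `TermRep M K (term 𝒯 inc act) W`. -/
theorem termRep_b13_of_actBound {M : StepModel C Op Hist} (hM : ∀ k o h X, M.Out k o h X = out 𝒯 inc act k o h X)
    {K : ℕ → (ℕ → ℝ) → C.BgB → Set (Op × Hist)} {W : Set (ℕ → ℝ)} {A : ℕ → (ℕ → ℝ) → C.BgB → P → J → ℝ}
    (hA : ∀ k, ∀ g ∈ W, ∀ (U : C.BgB) (q : Op × Hist), q ∈ K k g U → ∀ X : C.Dom, C.scale X = k →
      ∀ i, 𝒯.Rel k i X → ∀ m, ‖act (𝒯.poly i m) (𝒯.lab i m) q.1 q.2‖ ≤ A k g U (𝒯.poly i m) (𝒯.lab i m))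
    (hconv : ∀ k, ∀ g ∈ W, ∀ (U : C.BgB) (X : C.Dom), C.scale X = k → Summable (actMajorant 𝒯 inc (A k g U) k X)) :
    TermRep M K (term 𝒯 inc act) W :=
  termRep_of_summable 𝒯 inc act M hM K W fun k g hg U q hq X hX =>
    summable_term_of_actBound (hA k g hg U q hq X hX) (hconv k g hg U X hX)

/-! ## §3 The per-domain class bound from the same split -/

/-- [folklore] **CLASS BOUND FOR THE B13 FAMILY FROM THE SPLIT BINDERS, PER DOMAIN.**  For a step model with `M.Out = out 𝒯
inc act`: the activity majorant (i) of `termRep_b13_of_actBound` and (iii) a PER-DOMAIN BUDGET of the combinatorial majorant,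
`Summable (actMajorant (A k g U) k X) ∧ ∑' i, actMajorant (A k g U) k X i ≤ G · e^{−κd(X)}` at every step-`k` domain (the per-X
form in which (2.41) p. 21 is printed: *"|𝐄^{(k+1)}(X)| ≤ O(1)C₃ε₁exp(−(1−10δ)½Lκd_{k+1}(X))"*; displayed, locator only — the
decay factor is extracted inside the combinatorial sum, (2.27)∕(2.40)) ⟹ `ClassBound M K W κ G`
(`HasSum.norm_le_of_bounded`). -/
theorem classBound_b13_of_actBound {M : StepModel C Op Hist} (hM : ∀ k o h X, M.Out k o h X = out 𝒯 inc act k o h X)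
    {K : ℕ → (ℕ → ℝ) → C.BgB → Set (Op × Hist)} {W : Set (ℕ → ℝ)} {A : ℕ → (ℕ → ℝ) → C.BgB → P → J → ℝ} {κ G : ℝ}
    (hA : ∀ k, ∀ g ∈ W, ∀ (U : C.BgB) (q : Op × Hist), q ∈ K k g U → ∀ X : C.Dom, C.scale X = k →
      ∀ i, 𝒯.Rel k i X → ∀ m, ‖act (𝒯.poly i m) (𝒯.lab i m) q.1 q.2‖ ≤ A k g U (𝒯.poly i m) (𝒯.lab i m))
    (hbud : ∀ k, ∀ g ∈ W, ∀ (U : C.BgB) (X : C.Dom), C.scale X = k →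
      Summable (actMajorant 𝒯 inc (A k g U) k X) ∧ ∑' i, actMajorant 𝒯 inc (A k g U) k X i ≤ G * Real.exp (-(κ * C.d X))) :
    ClassBound M K W κ G := by
  intro k g hg U q hq X hX
  obtain ⟨hs, hG⟩ := hbud k g hg U X hX
  have hsum : HasSum (fun i => term 𝒯 inc act k i q.1 q.2 X) (M.Out k q.1 q.2 X) := by
    rw [hM, out_eq_tsum]
    exact (summable_term_of_actBound (hA k g hg U q hq X hX) hs).hasSum
  exact (hsum.norm_le_of_bounded hs.hasSum fun i => norm_term_le_actMajorant (hA k g hg U q hq X hX i)).trans hG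

end Split

end Summit.QuantumFields.BalabanUV.T4Continuum.B13TermRep

end
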